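/-
Copyright (c) 2026 the pub-hodgecm-mathlib formalisation cell (harness21).  Prover seat hodgecm-mathlib-K2Liu-p09 (g7): Track B «K2-LIT»,
hLiu418 = stmt-HodgeConjecture-24832; LEAD F0P6-plan RULING M-158d «A7-val road (σ)», small-side socket σ-5 (`hdecomp`) and σ-3∕σ-4 (`a₀`, `ha₀`) of the face (A4″-KR).
-/
import Summits.HodgeConjecture.HodgeConjecture.Theorems.K2LiuLeviDeltaBlockDSurjective    -- ★ p860651 `exists_mem_leviDeltaLoc_blkD_eq` (+ ★ I-2 `leviDeltaLoc`, `mem_leviDeltaLoc_iff`, `isSiegelDelta_of_mem_leviDeltaLoc`)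
import Summits.HodgeConjecture.HodgeConjecture.Theorems.K2LiuSiegelBlockDAbsDetDelta      -- ★ `one_lt_absDetDelta_of_blkD_eq_smul_one`; ★ `K2LiuLocalIntertwiningProperty` §2 (`blocks_matA_leviPart`, `skew_blkA_inv_mul_blkB`)
import Literature.NumberTheory.GaloisRepresentations.SemiLocalUnits                       -- ★ `SemiLocal.exists_norm_lt_one` (`π ≠ 0`, `‖π‖_v < 1`)
import HarnessLib

/-!
# Crux `HLiu418`, road `K2_Liu`, organ A7-val (σ): THE LEVI DECOMPOSITION `P_Δ(L⁺_v) = M_Δ · N_Δ` OF THE CM DOUBLED DATUM, AND A LEVI ELEMENT WITH `|det_Δ| ≠ 1`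

Cell `hodgecm-mathlib`, crux item hLiu418 = `stmt-HodgeConjecture-24832`; squad K2 ∕ K2Liu; prover K2Liu-p09 (g7), organ lead A7-val.  THEOREMS ONLY
(no `def`, no `instance`, no notation, no named-fact hypothesis, no `sorry`); lane `--supports stmt-HodgeConjecture-24832` (count-neutral helper).
CM currency of ★ I-2 `K2LiuA7ValueInstanceDefs` (`H_v = U(𝔻)(L⁺_v)`, `𝔻 = 𝕎 ⊕ −𝕎`, `J = hermD L e dV dW`; generic `T₀` with `hJD : hermD = (gramD T₀).map _`, instantiate with
★ `gramR_isSymm`, ★ `isUnit_det_gramR₀`, ★ `hermD_eq_map_gramD`).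

* §1 **`exists_leviDeltaLoc_mul_unipDeltaLocal`** (`hdecomp` of ★ `K2LiuA7ValueSocketSiegS.isLocalSiegelSection_of_levi_unip`, `M := leviDeltaLoc`): every `p ∈ P_Δ(L⁺_v)`
  is `m · u` with `m ∈ M_Δ` (★ I-2 `leviDeltaLoc = {B = C = 0}`) and `u ∈ N_Δ(L⁺_v)` (★ D10 `unipDeltaLocal`): `m := p · n(A⁻¹B)⁻¹` has adapted blocks `diag(A, D)`
  (★ `K2LiuLocalIntertwiningProperty.blocks_matA_leviPart`, K2Liu-p01) and `u := n(A⁻¹B)` (★ `nElem_mem_unipDeltaLocal`, `A⁻¹B` skew by ★ `skew_blkA_inv_mul_blkB`);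
  subtype form `exists_leviDeltaLoc_coe_mul_unipDeltaLocal` (for the `mΔ := M_Δ.subtype` currency of ★ V8e).
* §2 **`exists_leviDeltaLoc_one_lt_absDetDelta`** (`a₀`, `ha₀` of ★ `K2LiuA7ValueSocketLevi.hK₁χ_of_laws`, `n ≠ 0`): there is `a₀ ∈ M_Δ` with `1 < |det_Δ a₀|_v`, hence
  `|det_Δ a₀|_v ≠ 1`: take `D(a₀) = ι_v(π)·1` for a `π ∈ L⁺_v` with `0 < ‖π‖_v < 1` (★ `SemiLocal.exists_norm_lt_one`) by the surjectivity of the `D`-block on `M_Δ`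
  (★ `exists_mem_leviDeltaLoc_blkD_eq`), then `|det_Δ a₀|_v = ‖π‖_v^{−2n}` (★ `one_lt_absDetDelta_of_blkD_eq_smul_one`).
HONEST LABEL.  Count-neutral helper; it retires nothing by itself: `HC_CM` is proved only modulo the 7 printed citations (2 remaining named inputs:
hLiu418 = `stmt-HodgeConjecture-24832`, h413 = `stmt-HodgeConjecture-24833`) until rung 0 closes.

## References
* [HarrisKudlaSweet1996] M. Harris, S. Kudla, W. J. Sweet, *Theta dichotomy for unitary groups*, J. AMS 9 (1996), §1 (1.11)–(1.15) (`P_Δ = M_Δ N_Δ`, `det_Δ`).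
* [MoeglinWaldspurger1995] C. Mœglin, J.-L. Waldspurger, *Spectral decomposition and Eisenstein series* (1995), I.1.4, II.1.6 (standard parabolics `P = MN`).
* [Kudla1994] S. Kudla, Israel J. Math. 87 (1994), §3 (adapted blocks).
-/

set_option autoImplicit false
set_option linter.dupNamespace false -- the mandated namespace repeats `HodgeConjecture.HodgeConjecture`

noncomputable section

open NumberField IsDedekindDomain Matrix
open Literature.NumberTheory.GaloisRepresentations
open Literature.NumberTheory.Automorphic Literature.NumberTheory.Automorphic.UnitaryGroup
open Literature.NumberTheory.GelbartRogawski1991 Literature.NumberTheory.GelbartRogawski1991.GRConstruction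
open Literature.NumberTheory.GelbartRogawski1991.UnitaryDualPair
open Literature.NumberTheory.GelbartRogawski1991.UnitaryDualPair.LocalSplitting
open Literature.NumberTheory.GelbartRogawski1991.AdaptedBlocks
open Literature.NumberTheory.K2Lit.LocalSiegelDoubled
open Summit.HodgeConjecture.HodgeConjecture.Cruxes.HLiu418.K2LiuLocalIntertwiningProperty
open Summit.HodgeConjecture.HodgeConjecture.Cruxes.HLiu418.K2LiuA7ValueInstanceDefs
open Summit.HodgeConjecture.HodgeConjecture.Cruxes.HLiu418.K2LiuLeviDeltaBlockDSurjective
open Summit.HodgeConjecture.HodgeConjecture.Cruxes.HLiu418.K2LiuSiegelBlockDAbsDetDelta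

namespace Summit.HodgeConjecture.HodgeConjecture.Cruxes.HLiu418.K2LiuLeviDeltaDecomposition

variable (L : Type) [Field L] [NumberField L] [IsCMField L] [Algebra.IsQuadraticExtension (Fp L) L]
  {δ : L} (hcδ : IsCMField.complexConj L δ = -δ) (hδ : δ ≠ 0) {d : Fp L} (hd : δ * δ = algebraMap (Fp L) L d)
variable {N M n : ℕ} (e : Fin N × Fin M ≃ Fin n)
  (dV : Fin N → L) (hdV : ∀ i, IsCMField.complexConj L (dV i) = dV i)
  (dW : Fin M → L) (hdW : ∀ i, IsCMField.complexConj L (dW i) = dW i)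
variable (v : HeightOneSpectrum (𝓞 (Fp L)))
  {T₀ : Matrix (Fin n) (Fin n) (Fp L)} (hT₀ : T₀.IsSymm) (hT₀d : IsUnit T₀.det)
  (hJD : hermD L e dV hdV dW hdW = (gramD (Fp L) n T₀).map (algebraMap (Fp L) L))

/-! ## §1 The Levi decomposition `P_Δ(L⁺_v) = M_Δ · N_Δ` -/

omit [Algebra.IsQuadraticExtension (Fp L) L] in
include hJD in
/-- **`p = m · u`, `m ∈ M_Δ`, `u ∈ N_Δ`** for `p ∈ H_v` with `C(p) = 0`: `m := p · n(A⁻¹B)⁻¹` (blocks `diag(A, D)`, ★ `blocks_matA_leviPart`), `u := n(A⁻¹B)` (★ `nElem_mem_unipDeltaLocal`).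
[cite: HarrisKudlaSweet1996, §1 (1.11)] [cite: MoeglinWaldspurger1995, II.1.6] -/
theorem exists_leviDeltaLoc_mul_unipDeltaLocal_of_blkC {p : UnitaryGroup.localPi L (IsCMField.complexConj L) (n + n) (hermD L e dV hdV dW hdW) v}
    (hC : blkC (matA (Fp L) L (IsCMField.complexConj L) v n p) = 0) :
    ∃ m ∈ leviDeltaLoc L e dV hdV dW hdW v, ∃ u ∈ unipDeltaLocal (Fp L) L (IsCMField.complexConj L) v n (JD := hermD L e dV hdV dW hdW), p = m * u := by
  obtain ⟨-, hB, hC', -⟩ := blocks_matA_leviPart (Fp L) L (IsCMField.complexConj L) v n hJD hC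
  exact ⟨_, (mem_leviDeltaLoc_iff L e dV hdV dW hdW v _).2 ⟨hB, hC'⟩, _,
    nElem_mem_unipDeltaLocal (Fp L) L (IsCMField.complexConj L) v n hJD _ (skew_blkA_inv_mul_blkB (Fp L) L (IsCMField.complexConj L) v n hJD hC),
    (inv_mul_cancel_right p _).symm⟩

include hcδ hδ hd hT₀ hJD in
/-- **THE LEVI DECOMPOSITION `P_Δ(L⁺_v) = M_Δ · N_Δ`** (`hdecomp` of ★ `K2LiuA7ValueSocketSiegS.isLocalSiegelSection_of_levi_unip` with `M := leviDeltaLoc`): every Siegel element `p`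
(`IsSiegelDelta … p`, ★ `isSiegelDelta_iff_blkC_eq_zero`) is `m · u` with `m ∈ M_Δ`, `u ∈ N_Δ(L⁺_v)`. [cite: HarrisKudlaSweet1996, §1 (1.11)] [cite: MoeglinWaldspurger1995, II.1.6] -/
theorem exists_leviDeltaLoc_mul_unipDeltaLocal {p : UnitaryGroup.localPi L (IsCMField.complexConj L) (n + n) (hermD L e dV hdV dW hdW) v}
    (hp : IsSiegelDelta (Fp L) L (IsCMField.complexConj L) hcδ hδ hd v n hT₀ hJD p) :
    ∃ m ∈ leviDeltaLoc L e dV hdV dW hdW v, ∃ u ∈ unipDeltaLocal (Fp L) L (IsCMField.complexConj L) v n (JD := hermD L e dV hdV dW hdW), p = m * u :=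
  exists_leviDeltaLoc_mul_unipDeltaLocal_of_blkC L e dV hdV dW hdW v hJD
    ((isSiegelDelta_iff_blkC_eq_zero (Fp L) L (IsCMField.complexConj L) hcδ hδ hd v n hT₀ hJD p).1 hp)

include hcδ hδ hd hT₀ hJD in
/-- **`P_Δ(L⁺_v) = M_Δ · N_Δ`, subtype form** (`mΔ := M_Δ.subtype` currency of ★ V8e ∕ ★ `isLocalSiegelSection_of_levi_unip_hom`): `p = ↑a · u` with `a : ↥M_Δ`, `u ∈ N_Δ(L⁺_v)`.
[cite: HarrisKudlaSweet1996, §1 (1.11)] [cite: MoeglinWaldspurger1995, II.1.6] -/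
theorem exists_leviDeltaLoc_coe_mul_unipDeltaLocal {p : UnitaryGroup.localPi L (IsCMField.complexConj L) (n + n) (hermD L e dV hdV dW hdW) v}
    (hp : IsSiegelDelta (Fp L) L (IsCMField.complexConj L) hcδ hδ hd v n hT₀ hJD p) :
    ∃ (a : ↥(leviDeltaLoc L e dV hdV dW hdW v)) (u : UnitaryGroup.localPi L (IsCMField.complexConj L) (n + n) (hermD L e dV hdV dW hdW) v),
      u ∈ unipDeltaLocal (Fp L) L (IsCMField.complexConj L) v n (JD := hermD L e dV hdV dW hdW) ∧
        p = (a : UnitaryGroup.localPi L (IsCMField.complexConj L) (n + n) (hermD L e dV hdV dW hdW) v) * u := by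
  obtain ⟨m, hm, u, hu, hpu⟩ := exists_leviDeltaLoc_mul_unipDeltaLocal L hcδ hδ hd e dV hdV dW hdW v hT₀ hJD hp
  exact ⟨⟨m, hm⟩, u, hu, hpu⟩

include hcδ hδ hd hT₀ hJD in
/-- **the unipotent part is Siegel too** (and so is the Levi part `m = p u⁻¹`): `u ∈ N_Δ ⇒ IsSiegelDelta u` (★ D10 `isSiegelDelta_of_mem_unipDeltaLocal`), recorded in this currency.
[cite: HarrisKudlaSweet1996, §1 (1.11)] -/
theorem isSiegelDelta_of_mem_unipDeltaLocal' {u : UnitaryGroup.localPi L (IsCMField.complexConj L) (n + n) (hermD L e dV hdV dW hdW) v}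
    (hu : u ∈ unipDeltaLocal (Fp L) L (IsCMField.complexConj L) v n (JD := hermD L e dV hdV dW hdW)) :
    IsSiegelDelta (Fp L) L (IsCMField.complexConj L) hcδ hδ hd v n hT₀ hJD u :=
  isSiegelDelta_of_mem_unipDeltaLocal (Fp L) L (IsCMField.complexConj L) hcδ hδ hd v n hT₀ hJD hu

/-! ## §2 A Levi element `a₀ ∈ M_Δ` with `1 < |det_Δ a₀|_v` -/

include hcδ hδ hd hT₀ hT₀d hJD in
/-- **there is `a₀ ∈ M_Δ` with `D(a₀) = ι_v(π)·1`** for any `π ∈ L⁺_v` (★ `exists_mem_leviDeltaLoc_blkD_eq` at the scalar unit `ι_v(π)·1`, `π ≠ 0`).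
[cite: HarrisKudlaSweet1996, §1 (1.11)] [cite: Kudla1994, §3] -/
theorem exists_leviDeltaLoc_blkD_eq_smul_one {π : v.adicCompletion (Fp L)} (hπ0 : π ≠ 0) :
    ∃ a₀ : ↥(leviDeltaLoc L e dV hdV dW hdW v),
      blkD (matA (Fp L) L (IsCMField.complexConj L) v n (a₀ : UnitaryGroup.localPi L (IsCMField.complexConj L) (n + n) (hermD L e dV hdV dW hdW) v)) =
        toLocalRing L v π • (1 : Matrix (Fin n) (Fin n) (LocalRing L v)) := by
  obtain ⟨a₀, ha₀⟩ := exists_mem_leviDeltaLoc_blkD_eq L hcδ hδ hd e dV hdV dW hdW v hT₀ hT₀d hJD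
    (Units.map (Matrix.scalar (Fin n) : LocalRing L v →+* Matrix (Fin n) (Fin n) (LocalRing L v)).toMonoidHom
      (Units.map (toLocalRing L v).toMonoidHom (Units.mk0 π hπ0)))
  refine ⟨a₀, ?_⟩
  rw [ha₀, Units.coe_map, Units.coe_map, RingHom.toMonoidHom_eq_coe, RingHom.toMonoidHom_eq_coe, MonoidHom.coe_coe, MonoidHom.coe_coe,
    Units.val_mk0, Matrix.scalar_apply, Matrix.smul_one_eq_diagonal]

include hcδ hδ hd hT₀ hT₀d hJD in
/-- **`∃ a₀ ∈ M_Δ, 1 < |det_Δ a₀|_v`** (`n ≠ 0`): `D(a₀) = ι_v(π)·1` with `0 < ‖π‖_v < 1` (★ `SemiLocal.exists_norm_lt_one`), so `|det_Δ a₀|_v = ‖π‖_v^{−2n} > 1`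
(★ `one_lt_absDetDelta_of_blkD_eq_smul_one`). [cite: HarrisKudlaSweet1996, §1 (1.15)] [cite: Kudla1994, §3] -/
theorem exists_leviDeltaLoc_one_lt_absDetDelta (hn : n ≠ 0) :
    ∃ a₀ : ↥(leviDeltaLoc L e dV hdV dW hdW v),
      1 < absDetDelta (Fp L) L (IsCMField.complexConj L) v n (a₀ : UnitaryGroup.localPi L (IsCMField.complexConj L) (n + n) (hermD L e dV hdV dW hdW) v) := by
  obtain ⟨π, hπ0, hπ1⟩ := SemiLocal.exists_norm_lt_one (F := Fp L) (v := v)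
  obtain ⟨a₀, ha₀⟩ := exists_leviDeltaLoc_blkD_eq_smul_one L hcδ hδ hd e dV hdV dW hdW v hT₀ hT₀d hJD hπ0
  exact ⟨a₀, one_lt_absDetDelta_of_blkD_eq_smul_one (Fp L) L (IsCMField.complexConj L) v n hT₀d hJD
    ((mem_leviDeltaLoc_iff L e dV hdV dW hdW v _).1 a₀.2).2 hπ0 hπ1 hn ha₀⟩

include hcδ hδ hd hT₀ hT₀d hJD in
/-- **`∃ a₀ ∈ M_Δ, |det_Δ a₀|_v ≠ 1`** (`n ≠ 0`) — the pair `(a₀, ha₀)` of ★ `K2LiuA7ValueSocketLevi.hK₁χ_of_laws` with `mΔ := M_Δ.subtype`.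
[cite: HarrisKudlaSweet1996, §1 (1.15)] [cite: Kudla1994, §3] -/
theorem exists_leviDeltaLoc_absDetDelta_ne_one (hn : n ≠ 0) :
    ∃ a₀ : ↥(leviDeltaLoc L e dV hdV dW hdW v),
      absDetDelta (Fp L) L (IsCMField.complexConj L) v n (a₀ : UnitaryGroup.localPi L (IsCMField.complexConj L) (n + n) (hermD L e dV hdV dW hdW) v) ≠ 1 := by
  obtain ⟨a₀, ha₀⟩ := exists_leviDeltaLoc_one_lt_absDetDelta L hcδ hδ hd e dV hdV dW hdW v hT₀ hT₀d hJD hn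
  exact ⟨a₀, ha₀.ne'⟩

end Summit.HodgeConjecture.HodgeConjecture.Cruxes.HLiu418.K2LiuLeviDeltaDecomposition

end
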